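import Mathlib.RingTheory.Coalgebra.Convolution
import Mathlib.RingTheory.Coalgebra.Quotient
import Mathlib.RingTheory.HopfAlgebra.Quotient
import Mathlib.LinearAlgebra.Dual.Lemmas
import Mathlib.Algebra.Module.Projective
import HarnessLib

/-!
# The dual of a coalgebra quotient is a sub-convolution-algebra: transpose along a coalgebra surjection `B ↠ C` is an
# injective algebra map `C^* ↪ B^*` onto the functionals vanishing on the kernel; the dual of `0 → I → B → B ⧸ I → 0` is
# short exact when `B ⧸ I` is projective

Topic `Literature/RingTheory/HopfAlgebra`; namespace `Literature.RingTheory.HopfAlgebra`.  PROOF FILE (theorems only: no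
definition, no instance, no notation, no named fact, no `sorry`; Mathlib + HarnessLib only).  Cell `hodgecm-mathlib` (D-0151),
FLOOR 0, programme F0P5a (crux item stmt-HodgeConjecture-24832), KF8 «duality row» piece **CD3-lin** = the DEF-FREE linear-algebra
half of CD3 («Cartier duality swaps Hopf quotients and Hopf subalgebras; exactness»), sibling of ★ CD2-pts `FiniteDualPoints` (the
points of `B^* = WithConv (Module.Dual R B)`); the COALGEBRA structure on `B^*` (CD1) stays with the DEF desk and is not used here.

RESULTS (`R` a commutative (semi)ring, `B`, `C` coalgebras over `R`, `A` an `R`-algebra; `WithConv (C →ₗ[R] A)` is Mathlib's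
convolution algebra `(f * g)(c) = Σ f(c₁) g(c₂)`, unit `η ∘ ε`).
* §1 TRANSPOSE ALONG A COALGEBRA HOM `π : B →ₗc[R] C` — `convOne_comp_coalgHom` (unit), Mathlib's `convMul_comp_coalgHom_distrib`
  (product) ⇒ **`existsUnique_algHom_comp_coalgHom`**: a unique `R`-algebra map `Ψ : WithConv (C →ₗ[R] A) →ₐ[R] WithConv (B →ₗ[R] A)`
  with `(Ψ f).ofConv = f.ofConv ∘ₗ π`; `comp_coalgHom_injective` — it is injective when `π` is onto; `range_comp_eq_ker_le` — for
  `π` onto, `g : B →ₗ[R] A` is a transpose iff `ker π ≤ ker g`.  [Sweedler, *Hopf algebras* §1.2 / Montgomery 1.2.3 and 9.1.1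
  («`C^*` is an algebra … `π^*` is an algebra map»); Tate (3.8)]
* §2 THE QUOTIENT BY A COIDEAL `I` (Mathlib `Coalgebra.Quotient.mkQCoalgHom I : B →ₗc[R] B ⧸ I`): `existsUnique_algHom_comp_mkQ`,
  **`range_comp_mkQ_eq`** — the image of `(B ⧸ I)^* ↪ B^*` is `{g | I ≤ ker g}`; for `A = R`: `range_dualMap_mkQ_eq_dualAnnihilator`
  (= Mathlib `Submodule.range_dualMap_mkQ_eq` read on the coideal) — «the dual of the Hopf QUOTIENT `B ⧸ I` is the sub-convolution-
  algebra `ann(I) ⊆ B^*`».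
* §3 EXACTNESS: `dualMap_mkQ_injective` (Mathlib `LinearMap.dualMap_injective_of_surjective`), `exact_dualMap_mkQ_dualMap_subtype`
  (middle exactness `range mkQ^* = ann(I) = ker subtype^*`, Mathlib `range_dualMap_mkQ_eq`) and **`dualMap_subtype_surjective_of_projective`**
  — if `M ⧸ W` is a PROJECTIVE `R`-module then restriction `M^* → W^*` is onto (the sequence splits, Mathlib
  `Module.projective_lifting_property`); so the dual of `0 → I → B → B ⧸ I → 0` is SHORT EXACT whenever `B ⧸ I` is projective — e.g.
  finite free over a valuation ring (★ G2d `free_quotient_comap_includeRight_of_valuationRing`).  [Bourbaki *Algèbre* II §2.5–2.6;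
  Tate (3.8) «`A ↦ A′ = Hom_R(A, R)` is exact on finite free modules»]

HC_CM is proved only modulo the 7 printed citations until rung 0 closes; generic algebra, changes no count.

## References
* [Tate1997FiniteFlatGroupSchemes] J. Tate, *Finite flat group schemes*, in: Modular Forms and Fermat's Last Theorem (1997), §(3.8)
  (the dual Hopf algebra `A′ = Hom_R(A, R)`; duality is exact and swaps quotients with subobjects).
* [Montgomery1993Hopf] S. Montgomery, *Hopf algebras and their actions on rings*, CBMS 82 (1993), Lemma 1.2.2–1.2.3 (the dual algebra
  `C^*`), 9.1.1.
-/

set_option autoImplicit false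

namespace Literature.RingTheory.HopfAlgebra

open WithConv Coalgebra

universe u v w x

/-! ### §1 Transpose along a coalgebra homomorphism is an algebra homomorphism of convolution algebras -/

section Transpose

variable {R : Type u} [CommSemiring R] {B : Type v} {C : Type w} [AddCommMonoid B] [Module R B] [Coalgebra R B]
  [AddCommMonoid C] [Module R C] [Coalgebra R C] {A : Type x} [Semiring A] [Algebra R A]

/-- **The transpose of a coalgebra map preserves the convolution unit**: `(η_A ∘ ε_C) ∘ π = η_A ∘ ε_B` since `ε_C ∘ π = ε_B`.
(Mathlib's `LinearMap.convOne_comp_coalgHom` is the special case with the Hopf algebra itself as codomain.)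
[cite: Montgomery1993Hopf, §1.2 Lemma 1.2.2 and 9.1.1] -/
theorem convOne_comp_coalgHom (π : B →ₗc[R] C) :
    (1 : WithConv (C →ₗ[R] A)).ofConv ∘ₗ π.toLinearMap = (1 : WithConv (B →ₗ[R] A)).ofConv := by
  ext b
  simp [LinearMap.convOne_def]

/-- **The transpose of a coalgebra map is multiplicative for the convolution products**:
`(f * g) ∘ π = (f ∘ π) * (g ∘ π)` (Mathlib `convMul_comp_coalgHom_distrib`, recorded in the shape used below).
[cite: Montgomery1993Hopf, §1.2 Lemma 1.2.2 and 9.1.1] -/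
theorem convMul_comp_coalgHom (π : B →ₗc[R] C) (f g : WithConv (C →ₗ[R] A)) :
    toConv ((f * g).ofConv ∘ₗ π.toLinearMap) =
      toConv (f.ofConv ∘ₗ π.toLinearMap) * toConv (g.ofConv ∘ₗ π.toLinearMap) := by
  apply ofConv_injective
  exact LinearMap.convMul_comp_coalgHom_distrib f g π

/-- **Transpose along a coalgebra map `π : B → C` is an `R`-ALGEBRA map `C^* → B^*` of convolution algebras** (`C^* = Hom_R(C, A)`
with convolution), stated def-free: there is a unique `R`-algebra homomorphism `Ψ : WithConv (C →ₗ[R] A) →ₐ[R] WithConv (B →ₗ[R] A)`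
with `(Ψ f) = f ∘ π` for all `f`. [cite: Montgomery1993Hopf, §1.2 Lemma 1.2.2–1.2.3 and 9.1.1] [cite: Tate1997FiniteFlatGroupSchemes,
§(3.8)] -/
theorem existsUnique_algHom_comp_coalgHom (π : B →ₗc[R] C) :
    ∃! Ψ : WithConv (C →ₗ[R] A) →ₐ[R] WithConv (B →ₗ[R] A), ∀ f, (Ψ f).ofConv = f.ofConv ∘ₗ π.toLinearMap := by
  -- the underlying linear map
  let L : WithConv (C →ₗ[R] A) →ₗ[R] WithConv (B →ₗ[R] A) :=
    { toFun := fun f => toConv (f.ofConv ∘ₗ π.toLinearMap)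
      map_add' := fun f g => by apply ofConv_injective; ext b; simp
      map_smul' := fun r f => by apply ofConv_injective; ext b; simp }
  refine ⟨AlgHom.ofLinearMap L ?_ ?_, fun f => rfl, fun Ψ hΨ => ?_⟩
  · apply ofConv_injective
    exact convOne_comp_coalgHom π
  · intro f g
    exact convMul_comp_coalgHom π f g
  · apply AlgHom.ext
    intro f
    apply ofConv_injective
    rw [hΨ f]
    rfl

/-- The transpose of a SURJECTIVE coalgebra map is injective on `C^* → B^*`. [cite: Tate1997FiniteFlatGroupSchemes, §(3.8)] -/
theorem comp_coalgHom_injective (π : B →ₗc[R] C) (hπ : Function.Surjective π)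
    (Ψ : WithConv (C →ₗ[R] A) →ₐ[R] WithConv (B →ₗ[R] A)) (hΨ : ∀ f, (Ψ f).ofConv = f.ofConv ∘ₗ π.toLinearMap) :
    Function.Injective Ψ := by
  intro f g h
  apply ofConv_injective
  apply LinearMap.ext
  intro c
  obtain ⟨b, rfl⟩ := hπ c
  have h' := congrArg (fun x => (x.ofConv : B →ₗ[R] A) b) h
  simp only [hΨ, LinearMap.coe_comp, Function.comp_apply] at h'
  exact h'

end Transpose

section TransposeRange

variable {R : Type u} [CommRing R] {B : Type v} {C : Type w} [AddCommGroup B] [Module R B] [Coalgebra R B]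
  [AddCommGroup C] [Module R C] [Coalgebra R C] {A : Type x} [Ring A] [Algebra R A]

/-- **Image of the transpose of a surjective coalgebra map**: `g : B → A` is of the form `f ∘ π` iff `g` kills `ker π`
(linear algebra: `π` identifies `C` with `B ⧸ ker π`). [cite: Tate1997FiniteFlatGroupSchemes, §(3.8)] -/
theorem mem_range_comp_coalgHom_iff (π : B →ₗc[R] C) (hπ : Function.Surjective π)
    (Ψ : WithConv (C →ₗ[R] A) →ₐ[R] WithConv (B →ₗ[R] A)) (hΨ : ∀ f, (Ψ f).ofConv = f.ofConv ∘ₗ π.toLinearMap)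
    (g : WithConv (B →ₗ[R] A)) :
    g ∈ Set.range Ψ ↔ LinearMap.ker π.toLinearMap ≤ LinearMap.ker g.ofConv := by
  constructor
  · rintro ⟨f, rfl⟩ b hb
    rw [LinearMap.mem_ker] at hb ⊢
    rw [hΨ, LinearMap.comp_apply, hb, map_zero]
  · intro hle
    -- factor `g` through `π` using surjectivity: `C ≃ B ⧸ ker π`
    have hπ' : Function.Surjective π.toLinearMap := hπ
    obtain ⟨f, hf⟩ : ∃ f : C →ₗ[R] A, f ∘ₗ π.toLinearMap = g.ofConv := by
      refine ⟨(LinearMap.ker π.toLinearMap).liftQ g.ofConv hle ∘ₗ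
          (π.toLinearMap.quotKerEquivOfSurjective hπ').symm.toLinearMap, ?_⟩
      apply LinearMap.ext
      intro b
      rw [LinearMap.comp_apply, LinearMap.comp_apply, LinearEquiv.coe_toLinearMap,
        LinearMap.quotKerEquivOfSurjective_symm_apply, Submodule.liftQ_apply]
    exact ⟨toConv f, by apply ofConv_injective; rw [hΨ]; exact hf⟩

end TransposeRange

/-! ### §2 The quotient by a coideal: `(B ⧸ I)^* ↪ B^*` is the sub-convolution-algebra of functionals vanishing on `I` -/

section Quotient

variable {R : Type u} [CommRing R] {B : Type v} [AddCommGroup B] [Module R B] [Coalgebra R B]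
  (I : Submodule R B) [I.IsCoideal] {A : Type x} [Ring A] [Algebra R A]

/-- **`(B ⧸ I)^* → B^*` is an `R`-algebra map of convolution algebras** (transpose of Mathlib's quotient coalgebra map
`Coalgebra.Quotient.mkQCoalgHom I`), def-free. [cite: Montgomery1993Hopf, §1.2 Lemma 1.2.3 and 9.1.1] -/
theorem existsUnique_algHom_comp_mkQ :
    ∃! Ψ : WithConv ((B ⧸ I) →ₗ[R] A) →ₐ[R] WithConv (B →ₗ[R] A), ∀ f, (Ψ f).ofConv = f.ofConv ∘ₗ I.mkQ :=
  existsUnique_algHom_comp_coalgHom (Coalgebra.Quotient.mkQCoalgHom I)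

/-- Injectivity of `(B ⧸ I)^* → B^*`. [cite: Tate1997FiniteFlatGroupSchemes, §(3.8)] -/
theorem comp_mkQ_injective (Ψ : WithConv ((B ⧸ I) →ₗ[R] A) →ₐ[R] WithConv (B →ₗ[R] A))
    (hΨ : ∀ f, (Ψ f).ofConv = f.ofConv ∘ₗ I.mkQ) : Function.Injective Ψ :=
  comp_coalgHom_injective (Coalgebra.Quotient.mkQCoalgHom I) I.mkQ_surjective Ψ hΨ

/-- **The image of `(B ⧸ I)^* ↪ B^*` is `{g | I ≤ ker g}`** — the functionals vanishing on the coideal `I` form the image, a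
SUBALGEBRA of the convolution algebra `B^*` («duality turns the quotient coalgebra `B ⧸ I` into the subalgebra `ann I`»).
[cite: Tate1997FiniteFlatGroupSchemes, §(3.8)] [cite: Montgomery1993Hopf, 9.1.1] -/
theorem mem_range_comp_mkQ_iff (Ψ : WithConv ((B ⧸ I) →ₗ[R] A) →ₐ[R] WithConv (B →ₗ[R] A))
    (hΨ : ∀ f, (Ψ f).ofConv = f.ofConv ∘ₗ I.mkQ) (g : WithConv (B →ₗ[R] A)) :
    g ∈ Set.range Ψ ↔ I ≤ LinearMap.ker g.ofConv := by
  rw [mem_range_comp_coalgHom_iff (Coalgebra.Quotient.mkQCoalgHom I) I.mkQ_surjective Ψ hΨ g]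
  change LinearMap.ker I.mkQ ≤ _ ↔ _
  rw [Submodule.ker_mkQ]

/-- **`A = R`: the image of `(B ⧸ I)^* ↪ B^* = Hom_R(B, R)` is the dual annihilator of `I`** (Mathlib
`Submodule.range_dualMap_mkQ_eq`, read through `WithConv`). [cite: Tate1997FiniteFlatGroupSchemes, §(3.8)] -/
theorem mem_range_comp_mkQ_iff_mem_dualAnnihilator (Ψ : WithConv ((B ⧸ I) →ₗ[R] R) →ₐ[R] WithConv (B →ₗ[R] R))
    (hΨ : ∀ f, (Ψ f).ofConv = f.ofConv ∘ₗ I.mkQ) (g : WithConv (B →ₗ[R] R)) :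
    g ∈ Set.range Ψ ↔ g.ofConv ∈ I.dualAnnihilator := by
  rw [mem_range_comp_mkQ_iff I Ψ hΨ g, Submodule.mem_dualAnnihilator]
  exact ⟨fun h w hw => h hw, fun h w hw => h w hw⟩

end Quotient

/-! ### §3 Exactness of the dual of `0 → W → M → M ⧸ W → 0` -/

section Exact

variable {R : Type u} [CommRing R] {M : Type v} [AddCommGroup M] [Module R M] (W : Submodule R M)

/-- `(M ⧸ W)^* → M^*` is injective (Mathlib `LinearMap.dualMap_injective_of_surjective`, recorded on `mkQ`).
[cite: Tate1997FiniteFlatGroupSchemes, §(3.8)] -/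
theorem dualMap_mkQ_injective : Function.Injective W.mkQ.dualMap :=
  LinearMap.dualMap_injective_of_surjective W.mkQ_surjective

/-- Middle exactness: **`range (mkQ^*) = ker (subtype^*)`** — a functional on `M` comes from `M ⧸ W` iff it vanishes on `W`
(Mathlib `Submodule.range_dualMap_mkQ_eq` and `LinearMap.ker_dualMap_eq_dualAnnihilator_range`).
[cite: Tate1997FiniteFlatGroupSchemes, §(3.8)] -/
theorem exact_dualMap_mkQ_dualMap_subtype : Function.Exact W.mkQ.dualMap W.subtype.dualMap := by
  rw [LinearMap.exact_iff, LinearMap.ker_dualMap_eq_dualAnnihilator_range, Submodule.range_subtype,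
    Submodule.range_dualMap_mkQ_eq]

/-- **Exactness on the right: if `M ⧸ W` is PROJECTIVE then restriction of functionals `M^* → W^*` is onto** — a section
`s` of `M → M ⧸ W` (Mathlib `Module.projective_lifting_property`) gives the retraction `m ↦ m − s(m̄)` of `W ⊆ M`, along which every
functional on `W` extends.  (Mathlib has the field case `LinearMap.dualMap_surjective_of_injective`.)  With `dualMap_mkQ_injective` and
`exact_dualMap_mkQ_dualMap_subtype`: the dual of `0 → W → M → M ⧸ W → 0` is SHORT EXACT — e.g. for `W = I` a Hopf ideal with `B ⧸ I`
finite free. [cite: Tate1997FiniteFlatGroupSchemes, §(3.8)] -/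
theorem dualMap_subtype_surjective_of_projective [Module.Projective R (M ⧸ W)] :
    Function.Surjective W.subtype.dualMap := by
  obtain ⟨s, hs⟩ := Module.projective_lifting_property W.mkQ (LinearMap.id : (M ⧸ W) →ₗ[R] (M ⧸ W)) W.mkQ_surjective
  have hs' : ∀ y : M ⧸ W, W.mkQ (s y) = y := fun y => LinearMap.congr_fun hs y
  -- the retraction `r m = m - s (m mod W) ∈ W`
  have hmem : ∀ m : M, ((LinearMap.id : M →ₗ[R] M) - s ∘ₗ W.mkQ) m ∈ W := fun m => by
    have h0 : W.mkQ (((LinearMap.id : M →ₗ[R] M) - s ∘ₗ W.mkQ) m) = 0 := by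
      rw [LinearMap.sub_apply, map_sub, LinearMap.id_apply, LinearMap.comp_apply, hs', sub_self]
    exact (Submodule.Quotient.mk_eq_zero W).mp h0
  intro φ
  refine ⟨φ ∘ₗ LinearMap.codRestrict W ((LinearMap.id : M →ₗ[R] M) - s ∘ₗ W.mkQ) hmem, ?_⟩
  apply LinearMap.ext
  intro w
  rw [LinearMap.dualMap_apply, LinearMap.comp_apply]
  congr 1
  apply Subtype.ext
  rw [LinearMap.codRestrict_apply, LinearMap.sub_apply, LinearMap.id_apply, LinearMap.comp_apply, Submodule.subtype_apply,
    Submodule.mkQ_apply, (Submodule.Quotient.mk_eq_zero W).mpr w.2, map_zero, sub_zero]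

end Exact

end Literature.RingTheory.HopfAlgebra
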